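import Literature.Geometry.Riemannian.ColdingMinicozziEntropy
import Mathlib
import HarnessLib

/-!
# Small-scale conformal domination for `S⁴ × ℝ → ℝ⁵`: the real-variable kernel comparison

Topic `Literature/Geometry/Riemannian`; companion of `SphericalCylinderConformalMap.lean` and
`SphericalCylinderSmallScaleDomination.lean`.  Pure real analysis behind the pointwise domination of the
pulled-back Euclidean Gaussian kernel of `ℝ⁵` by ONE slice-normalised cylinder kernel of `N = S⁴ × ℝ` plus
an "area atom", below the conformal scale.  In normalised variables (`u = s - log ‖y‖`,
`c = cos θ = ⟨z', y/‖y‖⟩`, `τ = t/‖y‖²`) the Jacobian-weighted pulled-back kernel is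
`(4πτ)⁻² e^{4u} exp(-Q_E/4τ)` with the "Euclidean defect" `Q_E = (eᵘ - 1)² + 2eᵘ(1 - c)`, while a cylinder
kernel of scale `σ` centred at `(ŷ, log ‖y‖)` is, after the Cheeger–Yau minorant of the `S⁴` heat kernel,
at least `(4πσ)⁻² exp(-(θ² + u²)/4σ)`.  Proved here (no definitions, no named facts):

* `near_compare` (+ `near_angle`, `near_height`, `near_exp_compare`): in the near region `Q_E ≤ ε²`
  (`ε ≤ 1/5`), `θ² + u² ≤ (1+κ) Q_E` and `u ≤ ε` as soon as `(1+κ)(1-ε)² ≥ 1` — the only losses are the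
  cubic asymmetry `u² - (eᵘ-1)² = -u³ + …` below the centre and `2(1 - cos θ) = θ² - θ⁴/12 + …`, both
  absorbed by the broadening `κ` (Taylor bound `Real.cos_bound`);
* `near_kernel_bound`: the un-normalised consequence
  `(4πt)⁻² e^{4s} e^{-‖y‖² Q_E/4t} ≤ e^{4ε}(1+κ)² (3/8π²) · Z · e^{-(s - log‖y‖)²/4σ}`, `σ = (1+κ)t/‖y‖²`,
  for any `Z ≥ (8π²/3)(4πσ)⁻² e^{-arccos(c)²/4σ}` (in the application `Z` is the typed zonal kernel);
* `far_bound`: in the far region `‖Φz - y‖² ≥ 4t(log(e⁴/6c₀) - 2 log(t e^{-2t₀}))` a point of height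
  `s ≤ t₀ + 1` contributes at most the area atom `c₀ · 3/(8π²)`;
* `smallness`: `16e² T (C + 2 log(1/T)) ≤ ε²` for `T ≤ (ε²/(16e²(C+4)))²`; `constants`: with
  `ε = δ/40`, `κ = 3ε`, `c₀ = δ/4`, `e^{4h} = 1 + δ/4` the total mass `(1+δ/4)(e^{4ε}(1+κ)² + δ/4) ≤ 1 + δ`
  (`0 < δ ≤ 1`); `gaussianNormalization_four`: `(4πt)^{-4/2} = ((4πt)²)⁻¹`.

## References
* J. Cheeger, S.-T. Yau, Comm. Pure Appl. Math. 34 (1981) 465–480 (the Gaussian minorant, motivation).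
-/

noncomputable section

open Set
open scoped ENNReal NNReal BigOperators

namespace Literature.Geometry.Riemannian.SphericalCylinderConformal


/-! ### The near-region comparison (normalised variables) -/


/-- `cos 1 ≤ 53/96` (from Mathlib's `Real.cos_bound`). [folklore] -/
theorem cos_one_le : Real.cos 1 ≤ 53 / 96 := by
  have h := Real.cos_bound (x := 1) (by norm_num)
  have h2 := (abs_sub_le_iff.1 h).1
  norm_num at h2
  linarith

/-- If `0 ≤ θ ≤ π` and `cos θ > 53/96` then `θ ≤ 1`. [folklore] -/
theorem le_one_of_cos_gt {θ : ℝ} (hπ : θ ≤ Real.pi) (hc : 53 / 96 < Real.cos θ) : θ ≤ 1 := by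
  by_contra h1
  push Not at h1
  have := Real.cos_lt_cos_of_nonneg_of_le_pi (by norm_num : (0 : ℝ) ≤ 1) hπ h1
  linarith [cos_one_le]

/-- **Angular part of the near-region comparison.** If `0 < ε ≤ 1/5`, `E ≥ 1 - ε`, `|c| ≤ 1` and
`2E(1 - c) ≤ ε²`, then `(1 - ε)² · arccos(c)² ≤ 2E(1 - c)`: below the scale `ε` the chordal defect
`2E(1 - cos θ)` of the conformal picture dominates the squared geodesic distance `θ²` of `S⁴` up to the
factor `(1 - ε)²` (Taylor bound `cos θ ≤ 1 - θ²/2 + 5θ⁴/96` on `|θ| ≤ 1`). [folklore] -/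
theorem near_angle {ε E c : ℝ} (hε : 0 < ε) (hε5 : ε ≤ 1 / 5) (hE : 1 - ε ≤ E) (hc1 : -1 ≤ c)
    (hc2 : c ≤ 1) (h : 2 * E * (1 - c) ≤ ε ^ 2) :
    (1 - ε) ^ 2 * (Real.arccos c) ^ 2 ≤ 2 * E * (1 - c) := by
  set θ := Real.arccos c with hθ
  have hθ0 : 0 ≤ θ := Real.arccos_nonneg c
  have hθπ : θ ≤ Real.pi := Real.arccos_le_pi c
  have hcos : Real.cos θ = c := Real.cos_arccos hc1 hc2
  have hE0 : 4 / 5 ≤ E := by linarith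
  -- `1 - c ≤ (5/8) ε² ≤ 1/40`
  have h1c : 1 - c ≤ 5 / 8 * ε ^ 2 := by nlinarith
  have hε2 : ε ^ 2 ≤ 1 / 25 := by nlinarith
  have hcgt : 53 / 96 < Real.cos θ := by rw [hcos]; nlinarith
  have hθ1 : θ ≤ 1 := le_one_of_cos_gt hθπ hcgt
  -- Taylor bound for `cos θ`
  have hb := Real.cos_bound (x := θ) (by rw [abs_of_nonneg hθ0]; exact hθ1)
  rw [abs_of_nonneg hθ0, hcos] at hb
  have hcb : c ≤ 1 - θ ^ 2 / 2 + θ ^ 4 * (5 / 96) := by linarith [(abs_sub_le_iff.1 hb).1]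
  have hθsq1 : θ ^ 2 ≤ 1 := by nlinarith
  have hθ4 : θ ^ 4 ≤ θ ^ 2 := by nlinarith [sq_nonneg θ]
  -- `θ² ≤ (96/43)(1 - c) ≤ (60/43) ε²`, hence `5θ²/48 ≤ ε`
  have hθsq : 43 / 96 * θ ^ 2 ≤ 1 - c := by nlinarith
  have hsmall : 5 * θ ^ 2 / 48 ≤ ε := by nlinarith
  -- conclude
  have hkey : θ ^ 2 / 2 * (1 - 5 * θ ^ 2 / 48) ≤ 1 - c := by nlinarith
  have h1 : 0 ≤ 1 - 5 * θ ^ 2 / 48 := by nlinarith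
  have h2 : 1 - ε ≤ 1 - 5 * θ ^ 2 / 48 := by linarith
  calc (1 - ε) ^ 2 * θ ^ 2 = 2 * (1 - ε) * (θ ^ 2 / 2 * (1 - ε)) := by ring
    _ ≤ 2 * E * (θ ^ 2 / 2 * (1 - 5 * θ ^ 2 / 48)) := by
        apply mul_le_mul
        · linarith
        · exact mul_le_mul_of_nonneg_left h2 (by positivity)
        · exact mul_nonneg (by positivity) (by linarith)
        · linarith
    _ ≤ 2 * E * (1 - c) := mul_le_mul_of_nonneg_left hkey (by linarith)

/-- **Radial part of the near-region comparison.** If `0 < ε < 1`, `0 ≤ κ`, `(1+κ)(1-ε)² ≥ 1` and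
`(eᵘ - 1)² ≤ ε²`, then `u² ≤ (1+κ)(eᵘ - 1)²`, `u ≤ ε` and `1 - ε ≤ eᵘ` (the cubic asymmetry
`u² - (eᵘ-1)² = -u³ + …` below the centre is absorbed by the broadening `κ`). [folklore] -/
theorem near_height {ε κ u : ℝ} (hε : 0 < ε) (hε1 : ε < 1) (hκ : 0 ≤ κ)
    (hκε : 1 ≤ (1 + κ) * (1 - ε) ^ 2) (hu : (Real.exp u - 1) ^ 2 ≤ ε ^ 2) :
    u ^ 2 ≤ (1 + κ) * (Real.exp u - 1) ^ 2 ∧ u ≤ ε ∧ 1 - ε ≤ Real.exp u := by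
  obtain ⟨hlo, hhi⟩ := abs_le_of_sq_le_sq' hu hε.le
  have hEpos : 0 < Real.exp u := Real.exp_pos u
  have hElo : 1 - ε ≤ Real.exp u := by linarith
  have huε : u ≤ ε := by
    have h1 : Real.exp u ≤ Real.exp ε := by linarith [Real.add_one_le_exp ε]
    exact Real.exp_le_exp.1 h1
  refine ⟨?_, huε, hElo⟩
  rcases le_or_gt 0 u with hu0 | hu0
  · -- `0 ≤ u ≤ eᵘ - 1`
    have h1 : u ≤ Real.exp u - 1 := by linarith [Real.add_one_le_exp u]
    have h2 : u ^ 2 ≤ (Real.exp u - 1) ^ 2 := pow_le_pow_left₀ hu0 h1 2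
    have h3 : (Real.exp u - 1) ^ 2 ≤ (1 + κ) * (Real.exp u - 1) ^ 2 := by
      nlinarith [sq_nonneg (Real.exp u - 1)]
    exact h2.trans h3
  · -- `u < 0`: `1 - eᵘ ≥ (-u) eᵘ ≥ (-u)(1-ε)`
    have h1 : -u + 1 ≤ Real.exp (-u) := Real.add_one_le_exp (-u)
    have h2 : (1 - u) * Real.exp u ≤ 1 := by
      have := mul_le_mul_of_nonneg_right h1 hEpos.le
      rwa [← Real.exp_add, neg_add_cancel, Real.exp_zero, show (-u + 1) = 1 - u by ring] at this
    have h3 : (-u) * (1 - ε) ≤ 1 - Real.exp u := by nlinarith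
    have h4 : 0 ≤ (-u) * (1 - ε) := by nlinarith
    have h5 : ((-u) * (1 - ε)) ^ 2 ≤ (1 - Real.exp u) ^ 2 := pow_le_pow_left₀ h4 h3 2
    calc u ^ 2 ≤ (1 + κ) * (1 - ε) ^ 2 * u ^ 2 := by nlinarith [sq_nonneg u]
      _ = (1 + κ) * ((-u) * (1 - ε)) ^ 2 := by ring
      _ ≤ (1 + κ) * (1 - Real.exp u) ^ 2 := mul_le_mul_of_nonneg_left h5 (by linarith)
      _ = (1 + κ) * (Real.exp u - 1) ^ 2 := by ring

/-- **Near-region comparison** (normalised variables `u = s - log|y|`, `c = cos θ`): for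
`0 < ε ≤ 1/5`, `0 ≤ κ`, `(1+κ)(1-ε)² ≥ 1`, `|c| ≤ 1` and `(eᵘ-1)² + 2eᵘ(1-c) ≤ ε²`,
`arccos(c)² + u² ≤ (1+κ)·((eᵘ-1)² + 2eᵘ(1-c))` and `u ≤ ε`. [folklore] -/
theorem near_compare {ε κ u c : ℝ} (hε : 0 < ε) (hε5 : ε ≤ 1 / 5) (hκ : 0 ≤ κ)
    (hκε : 1 ≤ (1 + κ) * (1 - ε) ^ 2) (hc1 : -1 ≤ c) (hc2 : c ≤ 1)
    (hnear : (Real.exp u - 1) ^ 2 + 2 * Real.exp u * (1 - c) ≤ ε ^ 2) :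
    (Real.arccos c) ^ 2 + u ^ 2 ≤ (1 + κ) * ((Real.exp u - 1) ^ 2 + 2 * Real.exp u * (1 - c)) ∧
      u ≤ ε := by
  have hA0 : 0 ≤ 2 * Real.exp u * (1 - c) := by positivity [Real.exp_pos u]
  have hB0 : 0 ≤ (Real.exp u - 1) ^ 2 := sq_nonneg _
  have hu : (Real.exp u - 1) ^ 2 ≤ ε ^ 2 := by linarith
  have hang : 2 * Real.exp u * (1 - c) ≤ ε ^ 2 := by linarith
  obtain ⟨h1, h2, h3⟩ := near_height hε (by linarith) hκ hκε hu
  have h4 := near_angle hε hε5 h3 hc1 hc2 hang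
  refine ⟨?_, h2⟩
  have h5 : (Real.arccos c) ^ 2 ≤ (1 + κ) * (2 * Real.exp u * (1 - c)) := by
    calc (Real.arccos c) ^ 2 ≤ (1 + κ) * (1 - ε) ^ 2 * (Real.arccos c) ^ 2 := by
          nlinarith [sq_nonneg (Real.arccos c)]
      _ = (1 + κ) * ((1 - ε) ^ 2 * (Real.arccos c) ^ 2) := by ring
      _ ≤ (1 + κ) * (2 * Real.exp u * (1 - c)) := mul_le_mul_of_nonneg_left h4 (by linarith)
  nlinarith

/-- Exponential form of the near-region comparison: for every `a ≥ 0`,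
`e^{4u} e^{-a·Q_E} ≤ e^{4ε} e^{-a(θ² + u²)/(1+κ)}` with `Q_E = (eᵘ-1)² + 2eᵘ(1-c)`, `θ = arccos c`.
[folklore] -/
theorem near_exp_compare {ε κ u c a : ℝ} (hε : 0 < ε) (hε5 : ε ≤ 1 / 5) (hκ : 0 ≤ κ)
    (hκε : 1 ≤ (1 + κ) * (1 - ε) ^ 2) (hc1 : -1 ≤ c) (hc2 : c ≤ 1)
    (hnear : (Real.exp u - 1) ^ 2 + 2 * Real.exp u * (1 - c) ≤ ε ^ 2) (ha : 0 ≤ a) :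
    Real.exp (4 * u) * Real.exp (-(a * ((Real.exp u - 1) ^ 2 + 2 * Real.exp u * (1 - c)))) ≤
      Real.exp (4 * ε) * Real.exp (-(a * ((Real.arccos c) ^ 2 + u ^ 2) / (1 + κ))) := by
  obtain ⟨h1, h2⟩ := near_compare hε hε5 hκ hκε hc1 hc2 hnear
  have hκ1 : 0 < 1 + κ := by linarith
  refine mul_le_mul (Real.exp_le_exp.2 (by linarith)) (Real.exp_le_exp.2 ?_) (Real.exp_pos _).le
    (Real.exp_pos _).le
  rw [neg_le_neg_iff, div_le_iff₀ hκ1]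
  calc a * ((Real.arccos c) ^ 2 + u ^ 2)
      ≤ a * ((1 + κ) * ((Real.exp u - 1) ^ 2 + 2 * Real.exp u * (1 - c))) :=
        mul_le_mul_of_nonneg_left h1 ha
    _ = a * ((Real.exp u - 1) ^ 2 + 2 * Real.exp u * (1 - c)) * (1 + κ) := by ring

/-! ### Pure-real kernel lemmas -/

/-- **Far-region bound.** With `T = t e^{-2t₀}` and `Λ = log(e⁴/(6c₀)) - 2 log T`, a point at squared
distance `D ≥ 4tΛ` from the centre and of height `s ≤ t₀ + 1` contributes at most the "area atom":
`(4πt)⁻² e^{4s} e^{-D/4t} ≤ c₀ · 3/(8π²)`. [folklore] -/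
theorem far_bound {t t₀ s c₀ D : ℝ} (ht : 0 < t) (hc₀ : 0 < c₀) (hs : s ≤ t₀ + 1)
    (hfar : 4 * t * (Real.log (Real.exp 4 / (6 * c₀)) - 2 * Real.log (t * Real.exp (-2 * t₀))) ≤ D) :
    ((4 * Real.pi * t) ^ 2)⁻¹ * Real.exp (4 * s) * Real.exp (-D / (4 * t)) ≤
      c₀ * (3 / (8 * Real.pi ^ 2)) := by
  set T := t * Real.exp (-2 * t₀) with hT_def
  have hT : 0 < T := by positivity
  have hπ : 0 < Real.pi := Real.pi_pos
  have h1 : Real.exp (-D / (4 * t)) ≤ 6 * c₀ / Real.exp 4 * T ^ 2 := by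
    have h4t : 0 < 4 * t := by positivity
    have hle : -D / (4 * t) ≤ -(Real.log (Real.exp 4 / (6 * c₀)) - 2 * Real.log T) := by
      rw [div_le_iff₀ h4t]
      nlinarith
    calc Real.exp (-D / (4 * t)) ≤ Real.exp (-(Real.log (Real.exp 4 / (6 * c₀)) - 2 * Real.log T)) :=
          Real.exp_le_exp.2 hle
      _ = 6 * c₀ / Real.exp 4 * T ^ 2 := by
          have hT2 : Real.exp (2 * Real.log T) = T ^ 2 := by
            rw [show (2 : ℝ) * Real.log T = Real.log (T ^ 2) by rw [Real.log_pow]; norm_num,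
              Real.exp_log (by positivity)]
          rw [neg_sub, Real.exp_sub, hT2, Real.exp_log (by positivity)]
          field_simp
  have h2 : Real.exp (4 * s) ≤ Real.exp (4 * t₀ + 4) := Real.exp_le_exp.2 (by linarith)
  have hexp : Real.exp (4 * t₀ + 4) * Real.exp (-2 * t₀) ^ 2 = Real.exp 4 := by
    rw [← Real.exp_nat_mul, ← Real.exp_add]; congr 1; push_cast; ring
  have hE : Real.exp (4 * t₀ + 4) * (6 * c₀ / Real.exp 4 * T ^ 2) = 6 * c₀ * t ^ 2 := by
    calc Real.exp (4 * t₀ + 4) * (6 * c₀ / Real.exp 4 * T ^ 2)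
        = 6 * c₀ / Real.exp 4 * (Real.exp (4 * t₀ + 4) * Real.exp (-2 * t₀) ^ 2) * t ^ 2 := by
          rw [hT_def]; ring
      _ = 6 * c₀ / Real.exp 4 * Real.exp 4 * t ^ 2 := by rw [hexp]
      _ = 6 * c₀ * t ^ 2 := by field_simp
  calc ((4 * Real.pi * t) ^ 2)⁻¹ * Real.exp (4 * s) * Real.exp (-D / (4 * t))
      ≤ ((4 * Real.pi * t) ^ 2)⁻¹ * Real.exp (4 * t₀ + 4) * (6 * c₀ / Real.exp 4 * T ^ 2) := by
        gcongr
    _ = ((4 * Real.pi * t) ^ 2)⁻¹ * (6 * c₀ * t ^ 2) := by rw [mul_assoc, hE]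
    _ = c₀ * (3 / (8 * Real.pi ^ 2)) := by field_simp; ring

/-- **Near-region kernel bound** (un-normalised form of `near_exp_compare`): for a centre of norm
`r > 0`, scale `t > 0`, a point of `N` at height `s` making cosine `P` with the centre direction, in the
near region `(eˢ/r - 1)² + 2(eˢ/r)(1 - P) ≤ ε²`, the Jacobian-weighted Euclidean kernel
`(4πt)⁻² e^{4s} e^{-‖Φz-y‖²/4t}` is at most `e^{4ε}(1+κ)² · (3/8π²) · Z · e^{-(s - log r)²/4σ}`,
`σ = t(1+κ)/r²`, for any `Z` dominating the Cheeger–Yau minorant `(8π²/3)(4πσ)⁻² e^{-arccos(P)²/4σ}`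
(in the application `Z = 𝔥(σ, P)`, the typed zonal kernel). [folklore] -/
theorem near_kernel_bound {ε κ t r s P Z : ℝ} (hε : 0 < ε) (hε5 : ε ≤ 1 / 5) (hκ : 0 ≤ κ)
    (hκε : 1 ≤ (1 + κ) * (1 - ε) ^ 2) (ht : 0 < t) (hr : 0 < r) (hP1 : -1 ≤ P) (hP2 : P ≤ 1)
    (hnear : (Real.exp s / r - 1) ^ 2 + 2 * (Real.exp s / r) * (1 - P) ≤ ε ^ 2)
    (hZ : (8 * Real.pi ^ 2 / 3) * ((4 * Real.pi * (t * (1 + κ) / r ^ 2)) ^ 2)⁻¹ *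
        Real.exp (-(Real.arccos P) ^ 2 / (4 * (t * (1 + κ) / r ^ 2))) ≤ Z) :
    ((4 * Real.pi * t) ^ 2)⁻¹ * Real.exp (4 * s) *
        Real.exp (-(r ^ 2 * ((Real.exp s / r - 1) ^ 2 + 2 * (Real.exp s / r) * (1 - P))) / (4 * t)) ≤
      Real.exp (4 * ε) * (1 + κ) ^ 2 * (3 / (8 * Real.pi ^ 2)) *
        (Z * Real.exp (-(s - Real.log r) ^ 2 / (4 * (t * (1 + κ) / r ^ 2)))) := by
  have hπ : 0 < Real.pi := Real.pi_pos
  set u := s - Real.log r with hu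
  have hEu : Real.exp u = Real.exp s / r := by rw [hu, Real.exp_sub, Real.exp_log hr]
  set σ := t * (1 + κ) / r ^ 2 with hσ
  have hκ1 : 0 < 1 + κ := by linarith
  have hσpos : 0 < σ := by positivity
  have hcmp := near_exp_compare (u := u) (a := r ^ 2 / (4 * t)) hε hε5 hκ hκε hP1 hP2
    (by rwa [hEu]) (by positivity)
  rw [hEu] at hcmp
  set Q := (Real.exp s / r - 1) ^ 2 + 2 * (Real.exp s / r) * (1 - P) with hQ
  set θ := Real.arccos P with hθ
  have h4s : Real.exp (4 * s) = r ^ 4 * Real.exp (4 * u) := by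
    have : Real.exp (4 * u) = (Real.exp s / r) ^ 4 := by rw [← hEu, ← Real.exp_nat_mul]; norm_num
    rw [this, div_pow, mul_div_cancel₀ _ (by positivity), ← Real.exp_nat_mul]; norm_num
  have hsplit : Real.exp (-(r ^ 2 / (4 * t) * (θ ^ 2 + u ^ 2) / (1 + κ))) =
      Real.exp (-θ ^ 2 / (4 * σ)) * Real.exp (-u ^ 2 / (4 * σ)) := by
    rw [← Real.exp_add]
    congr 1
    rw [hσ]
    field_simp
    ring
  have hpref : ((4 * Real.pi * t) ^ 2)⁻¹ * r ^ 4 = (1 + κ) ^ 2 * ((4 * Real.pi * σ) ^ 2)⁻¹ := by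
    rw [hσ]
    field_simp
  have hZ' : ((4 * Real.pi * σ) ^ 2)⁻¹ * Real.exp (-θ ^ 2 / (4 * σ)) ≤ 3 / (8 * Real.pi ^ 2) * Z := by
    have h := mul_le_mul_of_nonneg_left hZ (show (0 : ℝ) ≤ 3 / (8 * Real.pi ^ 2) by positivity)
    calc ((4 * Real.pi * σ) ^ 2)⁻¹ * Real.exp (-θ ^ 2 / (4 * σ))
        = 3 / (8 * Real.pi ^ 2) * ((8 * Real.pi ^ 2 / 3) * ((4 * Real.pi * σ) ^ 2)⁻¹ *
            Real.exp (-θ ^ 2 / (4 * σ))) := by field_simp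
      _ ≤ 3 / (8 * Real.pi ^ 2) * Z := h
  calc ((4 * Real.pi * t) ^ 2)⁻¹ * Real.exp (4 * s) * Real.exp (-(r ^ 2 * Q) / (4 * t))
      = ((4 * Real.pi * t) ^ 2)⁻¹ * r ^ 4 * (Real.exp (4 * u) * Real.exp (-(r ^ 2 / (4 * t) * Q))) := by
        rw [h4s, show -(r ^ 2 * Q) / (4 * t) = -(r ^ 2 / (4 * t) * Q) by ring]; ring
    _ ≤ ((4 * Real.pi * t) ^ 2)⁻¹ * r ^ 4 *
          (Real.exp (4 * ε) * Real.exp (-(r ^ 2 / (4 * t) * (θ ^ 2 + u ^ 2) / (1 + κ)))) :=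
        mul_le_mul_of_nonneg_left hcmp (by positivity)
    _ = Real.exp (4 * ε) * (1 + κ) ^ 2 * (((4 * Real.pi * σ) ^ 2)⁻¹ * Real.exp (-θ ^ 2 / (4 * σ))) *
          Real.exp (-u ^ 2 / (4 * σ)) := by rw [hsplit, hpref]; ring
    _ ≤ Real.exp (4 * ε) * (1 + κ) ^ 2 * (3 / (8 * Real.pi ^ 2) * Z) * Real.exp (-u ^ 2 / (4 * σ)) := by
        gcongr
    _ = _ := by ring

/-- **Smallness of the near region.** If `0 < T ≤ (ε²/(16e²(C+4)))²` (`0 ≤ C`, `0 < ε ≤ 1`) then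
`16 e² T (C + 2 log(1/T)) ≤ ε²`. [folklore] -/
theorem smallness {T C ε : ℝ} (hT : 0 < T) (hε : 0 < ε) (hε1 : ε ≤ 1) (hC : 0 ≤ C)
    (hTle : T ≤ (ε ^ 2 / (16 * Real.exp 2 * (C + 4))) ^ 2) :
    16 * Real.exp 2 * T * (C + 2 * Real.log (1 / T)) ≤ ε ^ 2 := by
  set B := ε ^ 2 / (16 * Real.exp 2 * (C + 4)) with hB
  have he : (1 : ℝ) ≤ Real.exp 2 := Real.one_le_exp (by norm_num)
  have hB0 : 0 < B := by positivity
  have hB1 : B ≤ 1 := by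
    rw [hB, div_le_one (by positivity)]
    nlinarith
  set S := Real.sqrt T with hS
  have hS0 : 0 < S := Real.sqrt_pos.2 hT
  have hST : S ^ 2 = T := Real.sq_sqrt hT.le
  have hSB : S ≤ B := by
    rw [hS, ← Real.sqrt_sq hB0.le]
    exact Real.sqrt_le_sqrt hTle
  have hS1 : S ≤ 1 := hSB.trans hB1
  have hlog : Real.log (1 / T) ≤ 2 / S := by
    have h1 : Real.log (1 / S) ≤ 1 / S - 1 := Real.log_le_sub_one_of_pos (by positivity)
    have h2 : Real.log (1 / T) = 2 * Real.log (1 / S) := by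
      rw [← hST, one_div, one_div, Real.log_inv, Real.log_inv, Real.log_pow]; push_cast; ring
    rw [h2]
    have h3 : 1 / S - 1 ≤ 1 / S := by linarith
    calc 2 * Real.log (1 / S) ≤ 2 * (1 / S) := by linarith
      _ = 2 / S := by ring
  have hkey : T * (C + 2 * Real.log (1 / T)) ≤ S * (C + 4) := by
    have h1 : T * (C + 2 * Real.log (1 / T)) ≤ T * (C + 2 * (2 / S)) := by
      apply mul_le_mul_of_nonneg_left _ hT.le
      linarith
    have h2 : T * (C + 2 * (2 / S)) = S ^ 2 * C + 4 * S := by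
      rw [← hST]; field_simp; norm_num
    have h3 : S ^ 2 ≤ S := by nlinarith
    nlinarith
  calc 16 * Real.exp 2 * T * (C + 2 * Real.log (1 / T))
      = 16 * Real.exp 2 * (T * (C + 2 * Real.log (1 / T))) := by ring
    _ ≤ 16 * Real.exp 2 * (S * (C + 4)) := mul_le_mul_of_nonneg_left hkey (by positivity)
    _ ≤ 16 * Real.exp 2 * (B * (C + 4)) := by gcongr
    _ = ε ^ 2 := by rw [hB]; field_simp

/-- **The constants.** For `0 < δ ≤ 1`, `ε = δ/40`, `κ = 3ε`: `ε ≤ 1/5`, `(1+κ)(1-ε)² ≥ 1` and the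
total mass `(1 + δ/4) · (e^{4ε}(1+κ)² + δ/4) ≤ 1 + δ`. [folklore] -/
theorem constants {δ : ℝ} (hδ : 0 < δ) (hδ1 : δ ≤ 1) :
    δ / 40 ≤ 1 / 5 ∧ 1 ≤ (1 + 3 * (δ / 40)) * (1 - δ / 40) ^ 2 ∧
      (1 + δ / 4) * (Real.exp (4 * (δ / 40)) * (1 + 3 * (δ / 40)) ^ 2 + δ / 4) ≤ 1 + δ := by
  have hκε : 1 ≤ (1 + 3 * (δ / 40)) * (1 - δ / 40) ^ 2 := by
    have hx0 : 0 ≤ δ / 40 := by positivity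
    have hx1 : 0 ≤ 1 - 5 * (δ / 40) := by linarith
    have h := mul_nonneg hx0 hx1
    have h3 := pow_nonneg hx0 3
    nlinarith
  refine ⟨by linarith, hκε, ?_⟩
  have hx : |4 * (δ / 40)| ≤ 1 := by rw [abs_le]; constructor <;> linarith
  have he := Real.abs_exp_sub_one_sub_id_le hx
  have he' : Real.exp (4 * (δ / 40)) ≤ 1 + 11 / 100 * δ := by
    have := (abs_le.1 he).2
    nlinarith
  have hk : (1 + 3 * (δ / 40)) ^ 2 ≤ 1 + 16 / 100 * δ := by nlinarith
  have hc1 : Real.exp (4 * (δ / 40)) * (1 + 3 * (δ / 40)) ^ 2 ≤ 1 + 29 / 100 * δ := by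
    calc Real.exp (4 * (δ / 40)) * (1 + 3 * (δ / 40)) ^ 2 ≤ (1 + 11 / 100 * δ) * (1 + 16 / 100 * δ) :=
          mul_le_mul he' hk (sq_nonneg _) (by linarith)
      _ ≤ 1 + 29 / 100 * δ := by nlinarith
  calc (1 + δ / 4) * (Real.exp (4 * (δ / 40)) * (1 + 3 * (δ / 40)) ^ 2 + δ / 4)
      ≤ (1 + δ / 4) * (1 + 29 / 100 * δ + δ / 4) := by gcongr
    _ ≤ 1 + δ := by nlinarith


/-! ### The normalising factor in dimension four -/

/-- `(4πt)^{-4/2} = ((4πt)²)⁻¹` for `t > 0`: the normalising factor of `F_{y,t}` in dimension `4`.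
[folklore] -/
theorem gaussianNormalization_four {t : ℝ} (ht : 0 < t) :
    gaussianNormalization 4 t = ENNReal.ofReal (((4 * Real.pi * t) ^ 2)⁻¹) := by
  unfold gaussianNormalization
  congr 1
  rw [show (-((4 : ℕ) : ℝ) / 2) = -(2 : ℝ) by norm_num, Real.rpow_neg (by positivity), Real.rpow_two]


end Literature.Geometry.Riemannian.SphericalCylinderConformal

end
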